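import Literature.Probability.LatticeModels.FourFunctionsAE
import HarnessLib

/-!
# The four functions theorem under the ALMOST-EVERYWHERE hypothesis on finite products of ARBITRARY totally ordered
# σ-finite measure spaces (Batty–Bollmann 1980, Thm. 3.7 with Prop. 3.4, the "strongly 𝔐-expansive" case)

CITATION HEADER.  Source: C. J. K. Batty, H. W. Bollmann, *Generalised Holley–Preston inequalities on measure
spaces and their products*, Z. Wahrsch. verw. Gebiete **53** (1980) 157–173 [BattyBollmann1980], p. 159: "if
`(X, 𝔉, μ)` is a finite product of totally ordered measure spaces and `f₁, f₂, f₃` and `f₄` are measurable functions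
of `X` into `[0, ∞]` satisfying (1.7), then `(∫f₁ dμ)(∫f₂ dμ) ≤ (∫f₃ dμ)(∫f₄ dμ)` (1.13) … We shall see here that in
finite products this is the case, and indeed (1.13) is always valid if (1.7) holds `μ²`-a.e."; Prop. 3.4 ("any
selectively paired measure space is strongly 𝔐-expansive"), Lemma 3.6 (marginals of `μ`-compatible quadruples are
`μ₂`-compatible), Thm. 3.7 ("the direct product of any finite family of (strongly) 𝔐-expansive paired measure spaces is
(strongly) 𝔐-expansive").

The tree has the strong (almost-everywhere) form on `ℝ^ι` (`FourFunctionsAE.lean`: `lintegral_four_functions_ae`,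
from Prop. 2.1 `BattyBollmann.ae_diag_of_ae_pair` and Prop. 3.4 `BattyBollmann.lintegral_four_functions_real_ae`, the
latter already for an ARBITRARY linearly ordered measurable space) and the everywhere form for arbitrary chains
(`FourFunctionsProductChains.lean`).  This file closes the gap: **Thm. 3.7 in its printed generality — finite products
(dependent `Measure.pi`) of ARBITRARY linearly ordered measurable spaces with σ-finite measures, hypothesis for
`(⊗μᵢ) ⊗ (⊗μᵢ)`-almost every pair** — no relation between order and σ-algebra is needed anywhere.

* `fourFunctions_marginal_ae_pi` — Lemma 3.6 (`μ`-compatible case) for one coordinate of a dependent product over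
  `Fin (n+1)`: if the section quadruple at two base points `y, z` is compatible for `μᵢ ⊗ μᵢ`-a.e. pair of heights,
  the Lebesgue marginals over coordinate `i` satisfy the inequality at `(y, z)` (Prop. 3.4 a.e. on the chain `X i`).
* `lintegral_four_functions_pi_fin_ae`, `lintegral_four_functions_pi_ae` — **Thm. 3.7 (strong form)**: measurable
  `f₁,…,f₄ : (Π i, X i) → [0,∞]` with `f₁(x) f₂(y) ≤ f₃(x ∨ y) f₄(x ∧ y)` for a.e. pair satisfy
  `(∫⁻f₁)(∫⁻f₂) ≤ (∫⁻f₃)(∫⁻f₄)`; induction on the number of factors, transporting the a.e.-pair hypothesis through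
  `(Π j, X j) ≃ X 0 × Π j, X (succ j)` and splitting it by Fubini into "a.e. pair of base points, a.e. pair of heights".
* `mIsSetTP2_withDensity_pi_of_ae_chain`, `mIsAffiliated_withDensity_pi_of_ae_chain` — a density w.r.t. a product of
  σ-finite measures on arbitrary chains which is MTP₂ on almost every pair defines a set-TP₂, hence affiliated, law
  ((1.5)/Remark 3.1(d); [MullerStoyan2002] 3.10.14 (i) ⇒ (ii) ⇒ (iii) beyond `ℝ^ι`).

By [BattyBollmann1980] Example 2.3 (tree: `FourFunctionsAEInfinite.lean`) the a.e. form fails for infinite products.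
-/

noncomputable section

open MeasureTheory Set Filter
open scoped ENNReal SetFamily

namespace Literature.Probability.LatticeModels.BattyBollmann

universe u

/-! ### Re-association of fourfold products -/

section Shuffle

/-- `((y,z),(t,s)) ↦ ((t,y),(s,z))` preserves product measures (swaps and re-associations). [folklore] -/
private theorem measurePreserving_shuffle {α β γ δ : Type*} [MeasurableSpace α] [MeasurableSpace β]
    [MeasurableSpace γ] [MeasurableSpace δ] (μa : Measure α) (μb : Measure β) (μc : Measure γ)
    (μd : Measure δ) [SFinite μa] [SFinite μb] [SFinite μc] [SFinite μd] :
    MeasurePreserving (fun w : (α × β) × (γ × δ) => ((w.2.1, w.1.1), (w.2.2, w.1.2)))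
      ((μa.prod μb).prod (μc.prod μd)) ((μc.prod μa).prod (μd.prod μb)) := by
  have s1 : MeasurePreserving (Prod.swap : (α × β) × (γ × δ) → (γ × δ) × (α × β))
      ((μa.prod μb).prod (μc.prod μd)) ((μc.prod μd).prod (μa.prod μb)) := Measure.measurePreserving_swap
  have s2 : MeasurePreserving (MeasurableEquiv.prodAssoc : (γ × δ) × (α × β) ≃ᵐ γ × (δ × (α × β)))
      ((μc.prod μd).prod (μa.prod μb)) (μc.prod (μd.prod (μa.prod μb))) :=
    measurePreserving_prodAssoc μc μd (μa.prod μb)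
  have s3 : MeasurePreserving
      (Prod.map id (MeasurableEquiv.prodAssoc : (δ × α) × β ≃ᵐ δ × (α × β)).symm)
      (μc.prod (μd.prod (μa.prod μb))) (μc.prod ((μd.prod μa).prod μb)) :=
    (MeasurePreserving.id μc).prod ((measurePreserving_prodAssoc μd μa μb).symm _)
  have s4 : MeasurePreserving (Prod.map id (Prod.map Prod.swap id) : γ × ((δ × α) × β) → γ × ((α × δ) × β))
      (μc.prod ((μd.prod μa).prod μb)) (μc.prod ((μa.prod μd).prod μb)) :=
    (MeasurePreserving.id μc).prod (Measure.measurePreserving_swap.prod (MeasurePreserving.id μb))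
  have s5 : MeasurePreserving
      (Prod.map id (MeasurableEquiv.prodAssoc : (α × δ) × β ≃ᵐ α × (δ × β)))
      (μc.prod ((μa.prod μd).prod μb)) (μc.prod (μa.prod (μd.prod μb))) :=
    (MeasurePreserving.id μc).prod (measurePreserving_prodAssoc μa μd μb)
  have s6 : MeasurePreserving (MeasurableEquiv.prodAssoc : (γ × α) × (δ × β) ≃ᵐ γ × (α × (δ × β))).symm
      (μc.prod (μa.prod (μd.prod μb))) ((μc.prod μa).prod (μd.prod μb)) :=
    (measurePreserving_prodAssoc μc μa (μd.prod μb)).symm _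
  have e : (fun w : (α × β) × (γ × δ) => ((w.2.1, w.1.1), (w.2.2, w.1.2))) =
      (MeasurableEquiv.prodAssoc : (γ × α) × (δ × β) ≃ᵐ γ × (α × (δ × β))).symm ∘
        (Prod.map id (MeasurableEquiv.prodAssoc : (α × δ) × β ≃ᵐ α × (δ × β))) ∘
        (Prod.map id (Prod.map Prod.swap id) : γ × ((δ × α) × β) → γ × ((α × δ) × β)) ∘
        (Prod.map id (MeasurableEquiv.prodAssoc : (δ × α) × β ≃ᵐ δ × (α × β)).symm) ∘
        (MeasurableEquiv.prodAssoc : (γ × δ) × (α × β) ≃ᵐ γ × (δ × (α × β))) ∘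
        (Prod.swap : (α × β) × (γ × δ) → (γ × δ) × (α × β)) := by
    funext w
    rfl
  rw [e]
  exact s6.comp (s5.comp (s4.comp (s3.comp (s2.comp s1))))

end Shuffle

/-! ### The marginal step (Lemma 3.6, `μ`-compatible case) on a dependent product -/

section Marginal

variable {n : ℕ} {X : Fin (n + 1) → Type u} [∀ j, MeasurableSpace (X j)] [∀ j, LinearOrder (X j)]

omit [∀ j, MeasurableSpace (X j)] in
/-- `insertNth` commutes with the coordinatewise `⊔` (dependent tuples). [folklore] -/
private theorem insertNth_sup_dep (i : Fin (n + 1)) (t s : X i) (y z : ∀ j, X (i.succAbove j)) :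
    Fin.insertNth i t y ⊔ Fin.insertNth i s z = Fin.insertNth i (t ⊔ s) (y ⊔ z) := by
  have h := Fin.insertNth_binop (fun _ a b => a ⊔ b) i t s y z
  exact h.symm

omit [∀ j, MeasurableSpace (X j)] in
/-- `insertNth` commutes with the coordinatewise `⊓` (dependent tuples). [folklore] -/
private theorem insertNth_inf_dep (i : Fin (n + 1)) (t s : X i) (y z : ∀ j, X (i.succAbove j)) :
    Fin.insertNth i t y ⊓ Fin.insertNth i s z = Fin.insertNth i (t ⊓ s) (y ⊓ z) := by
  have h := Fin.insertNth_binop (fun _ a b => a ⊓ b) i t s y z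
  exact h.symm

omit [∀ j, LinearOrder (X j)] in
/-- Sections along `insertNth` are jointly measurable. [folklore] -/
private theorem measurable_section_insertNth {g : (∀ j, X j) → ℝ≥0∞} (hg : Measurable g) (i : Fin (n + 1)) :
    Measurable fun p : X i × (∀ j, X (i.succAbove j)) => g (Fin.insertNth i p.1 p.2) := by
  have hm : Measurable fun p : X i × (∀ j, X (i.succAbove j)) =>
      (MeasurableEquiv.piFinSuccAbove X i).symm p := (MeasurableEquiv.piFinSuccAbove X i).symm.measurable
  have e : (fun p : X i × (∀ j, X (i.succAbove j)) => g (Fin.insertNth i p.1 p.2)) =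
      fun p => g ((MeasurableEquiv.piFinSuccAbove X i).symm p) := by
    funext p
    rfl
  rw [e]
  exact hg.comp hm

omit [∀ j, LinearOrder (X j)] in
/-- The Lebesgue marginal `y ↦ ∫⁻ g(xᵢ := t, y) dν(t)` is measurable. [folklore] -/
private theorem measurable_lmarginal_insertNth {i : Fin (n + 1)} (ν : Measure (X i)) [SFinite ν]
    {g : (∀ j, X j) → ℝ≥0∞} (hg : Measurable g) :
    Measurable fun y : ∀ j, X (i.succAbove j) => ∫⁻ t, g (Fin.insertNth i t y) ∂ν :=
  (measurable_section_insertNth hg i).lintegral_prod_left'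

/-- **[BattyBollmann1980] Lemma 3.6, `μ`-compatible case, one coordinate of a dependent product of chains**: if, for
two base points `y, z`, the sections satisfy `f₁(t,y) f₂(s,z) ≤ f₃((t,y) ∨ (s,z)) f₄((t,y) ∧ (s,z))` for
`ν ⊗ ν`-ALMOST EVERY pair of heights `(t, s)` in the chain `X i`, then
`(∫ f₁(·,y))(∫ f₂(·,z)) ≤ (∫ f₃(·,y ∨ z))(∫ f₄(·,y ∧ z))` — Prop. 3.4 in its almost-everywhere form on `X i`
(`lintegral_four_functions_real_ae`). [cite: BattyBollmann1980, Lemma 3.6] -/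
theorem fourFunctions_marginal_ae_pi {i : Fin (n + 1)} (ν : Measure (X i)) [SFinite ν]
    {f₁ f₂ f₃ f₄ : (∀ j, X j) → ℝ≥0∞}
    (hm₁ : Measurable f₁) (hm₂ : Measurable f₂) (hm₃ : Measurable f₃) (hm₄ : Measurable f₄)
    (y z : ∀ j, X (i.succAbove j))
    (h : ∀ᵐ r ∂ν.prod ν, f₁ (Fin.insertNth i r.1 y) * f₂ (Fin.insertNth i r.2 z) ≤
      f₃ (Fin.insertNth i r.1 y ⊔ Fin.insertNth i r.2 z) * f₄ (Fin.insertNth i r.1 y ⊓ Fin.insertNth i r.2 z)) :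
    (∫⁻ t, f₁ (Fin.insertNth i t y) ∂ν) * (∫⁻ t, f₂ (Fin.insertNth i t z) ∂ν) ≤
      (∫⁻ t, f₃ (Fin.insertNth i t (y ⊔ z)) ∂ν) * (∫⁻ t, f₄ (Fin.insertNth i t (y ⊓ z)) ∂ν) := by
  have sec : ∀ {g : (∀ j, X j) → ℝ≥0∞}, Measurable g → ∀ w : ∀ j, X (i.succAbove j),
      Measurable fun t : X i => g (Fin.insertNth i t w) :=
    fun hg w => (measurable_section_insertNth hg i).comp (measurable_id.prodMk measurable_const)
  refine lintegral_four_functions_real_ae ν (sec hm₁ y) (sec hm₂ z) (sec hm₃ _) (sec hm₄ _) ?_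
  filter_upwards [h] with r hr
  rwa [insertNth_sup_dep, insertNth_inf_dep] at hr

end Marginal

/-! ### Thm. 3.7, strong (almost-everywhere) form, dependent products over `Fin n` -/

/-- **[BattyBollmann1980] Thm. 3.7 with Prop. 3.4 ("a finite product of totally ordered σ-finite measure spaces is
strongly 𝔐-expansive")**, products over `Fin n` of ARBITRARY linearly ordered measurable spaces `X j` (no relation
between order and σ-algebra), σ-finite `μⱼ`: measurable `f₁,…,f₄ : (Π j, X j) → [0,∞]` with
`f₁(x) f₂(y) ≤ f₃(x ∨ y) f₄(x ∧ y)` for `(⊗μⱼ) ⊗ (⊗μⱼ)`-ALMOST EVERY `(x, y)` satisfy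
`(∫⁻f₁)(∫⁻f₂) ≤ (∫⁻f₃)(∫⁻f₄)`.  Induction on `n` through `(Π j, X j) ≃ X 0 × Π j, X (succ j)`: the a.e. hypothesis
splits (Fubini) into "for a.e. pair of base points, for a.e. pair of heights", which is what
`fourFunctions_marginal_ae_pi` consumes, and the marginals inherit the a.e.-pair hypothesis.
[cite: BattyBollmann1980, Thm. 3.7] -/
theorem lintegral_four_functions_pi_fin_ae :
    ∀ (n : ℕ) (X : Fin n → Type u) [∀ j, MeasurableSpace (X j)] [∀ j, LinearOrder (X j)]
      (μ : ∀ j, Measure (X j)) [∀ j, SigmaFinite (μ j)] (f₁ f₂ f₃ f₄ : (∀ j, X j) → ℝ≥0∞),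
      Measurable f₁ → Measurable f₂ → Measurable f₃ → Measurable f₄ →
      (∀ᵐ p ∂(Measure.pi μ).prod (Measure.pi μ), f₁ p.1 * f₂ p.2 ≤ f₃ (p.1 ⊔ p.2) * f₄ (p.1 ⊓ p.2)) →
        (∫⁻ x, f₁ x ∂Measure.pi μ) * (∫⁻ x, f₂ x ∂Measure.pi μ) ≤
          (∫⁻ x, f₃ x ∂Measure.pi μ) * (∫⁻ x, f₄ x ∂Measure.pi μ)
  | 0, X, _, _, μ, _, f₁, f₂, f₃, f₄, hm₁, hm₂, hm₃, hm₄, h => by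
    let x₀ : ∀ j : Fin 0, X j := isEmptyElim
    have hpt : f₁ x₀ * f₂ x₀ ≤ f₃ (x₀ ⊔ x₀) * f₄ (x₀ ⊓ x₀) := by
      rw [Measure.pi_of_empty μ x₀, Measure.dirac_prod_dirac, ae_dirac_eq, eventually_pure] at h
      exact h
    rw [Measure.pi_of_empty μ x₀, lintegral_dirac' _ hm₁, lintegral_dirac' _ hm₂,
      lintegral_dirac' _ hm₃, lintegral_dirac' _ hm₄]
    simpa using hpt
  | n + 1, X, _, _, μ, _, f₁, f₂, f₃, f₄, hm₁, hm₂, hm₃, hm₄, h => by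
    set ν := μ 0 with hν
    set μ' : ∀ j : Fin n, Measure (X (Fin.succAbove 0 j)) := fun j => μ (Fin.succAbove 0 j) with hμ'
    have hmp := measurePreserving_piFinSuccAbove μ 0
    have split : ∀ {g : (∀ j, X j) → ℝ≥0∞}, Measurable g →
        ∫⁻ x, g x ∂Measure.pi μ = ∫⁻ y, (∫⁻ t, g (Fin.insertNth 0 t y) ∂ν) ∂Measure.pi μ' := by
      intro g hg
      have h1 := hmp.symm _ |>.lintegral_comp_emb (MeasurableEquiv.piFinSuccAbove X 0).symm.measurableEmbedding g
      rw [← h1]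
      have e : (fun p : X 0 × (∀ j, X (Fin.succAbove 0 j)) => g ((MeasurableEquiv.piFinSuccAbove X 0).symm p))
          = fun p => g (Fin.insertNth 0 p.1 p.2) := by
        funext p
        rfl
      rw [e, lintegral_prod_symm _ (measurable_section_insertNth hg 0).aemeasurable]
    rw [split hm₁, split hm₂, split hm₃, split hm₄]
    -- transport of the a.e.-pair hypothesis: for a.e. pair of base points, for a.e. pair of heights
    have h2 : ∀ᵐ q ∂(Measure.pi μ').prod (Measure.pi μ'), ∀ᵐ r ∂ν.prod ν,
        f₁ (Fin.insertNth 0 r.1 q.1) * f₂ (Fin.insertNth 0 r.2 q.2) ≤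
          f₃ (Fin.insertNth 0 r.1 q.1 ⊔ Fin.insertNth 0 r.2 q.2) *
            f₄ (Fin.insertNth 0 r.1 q.1 ⊓ Fin.insertNth 0 r.2 q.2) := by
      set e := MeasurableEquiv.piFinSuccAbove X 0 with he
      have hsymm : MeasurePreserving e.symm (ν.prod (Measure.pi μ')) (Measure.pi μ) := hmp.symm _
      have h3 := (hsymm.prod hsymm).quasiMeasurePreserving.ae h
      have h4 := (measurePreserving_shuffle (Measure.pi μ') (Measure.pi μ') ν ν).quasiMeasurePreserving.ae h3
      have h5 := Measure.ae_ae_of_ae_prod h4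
      filter_upwards [h5] with q hq
      filter_upwards [hq] with r hr
      exact hr
    refine lintegral_four_functions_pi_fin_ae n (fun j => X (Fin.succAbove 0 j)) μ' _ _ _ _
      (measurable_lmarginal_insertNth ν hm₁)
      (measurable_lmarginal_insertNth ν hm₂) (measurable_lmarginal_insertNth ν hm₃)
      (measurable_lmarginal_insertNth ν hm₄) ?_
    filter_upwards [h2] with q hq
    exact fourFunctions_marginal_ae_pi ν hm₁ hm₂ hm₃ hm₄ q.1 q.2 hq

/-! ### Thm. 3.7, strong form, general finite index type -/

section Fintype

variable {ι : Type*} [Fintype ι] {X : ι → Type u} [∀ i, MeasurableSpace (X i)] [∀ i, LinearOrder (X i)]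

omit [Fintype ι] [∀ i, MeasurableSpace (X i)] in
/-- A coordinate relabelling commutes with the coordinatewise `⊔` (dependent tuples). [folklore] -/
private theorem piCongrLeft_sup_dep {ι' : Type*} (e : ι' ≃ ι) (x y : ∀ b : ι', X (e b)) :
    (Equiv.piCongrLeft X e) (x ⊔ y) = Equiv.piCongrLeft X e x ⊔ Equiv.piCongrLeft X e y := by
  funext b
  obtain ⟨a, rfl⟩ := e.surjective b
  simp only [Equiv.piCongrLeft_apply_apply, Pi.sup_apply]

omit [Fintype ι] [∀ i, MeasurableSpace (X i)] in
/-- A coordinate relabelling commutes with the coordinatewise `⊓` (dependent tuples). [folklore] -/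
private theorem piCongrLeft_inf_dep {ι' : Type*} (e : ι' ≃ ι) (x y : ∀ b : ι', X (e b)) :
    (Equiv.piCongrLeft X e) (x ⊓ y) = Equiv.piCongrLeft X e x ⊓ Equiv.piCongrLeft X e y := by
  funext b
  obtain ⟨a, rfl⟩ := e.surjective b
  simp only [Equiv.piCongrLeft_apply_apply, Pi.inf_apply]

/-- **[BattyBollmann1980] Thm. 3.7, strong (almost-everywhere) form, for a general finite index type and arbitrary
totally ordered σ-finite factors** (relabelling `ι ≃ Fin n`): measurable `f₁,…,f₄ : (Π i, X i) → [0,∞]` with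
`f₁(x) f₂(y) ≤ f₃(x ∨ y) f₄(x ∧ y)` for `(⊗μᵢ) ⊗ (⊗μᵢ)`-almost every `(x, y)` satisfy
`(∫⁻f₁)(∫⁻f₂) ≤ (∫⁻f₃)(∫⁻f₄)`. [cite: BattyBollmann1980, Thm. 3.7] -/
theorem lintegral_four_functions_pi_ae (μ : ∀ i, Measure (X i)) [∀ i, SigmaFinite (μ i)]
    {f₁ f₂ f₃ f₄ : (∀ i, X i) → ℝ≥0∞} (hm₁ : Measurable f₁) (hm₂ : Measurable f₂) (hm₃ : Measurable f₃)
    (hm₄ : Measurable f₄)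
    (h : ∀ᵐ p ∂(Measure.pi μ).prod (Measure.pi μ), f₁ p.1 * f₂ p.2 ≤ f₃ (p.1 ⊔ p.2) * f₄ (p.1 ⊓ p.2)) :
    (∫⁻ x, f₁ x ∂Measure.pi μ) * (∫⁻ x, f₂ x ∂Measure.pi μ) ≤
      (∫⁻ x, f₃ x ∂Measure.pi μ) * (∫⁻ x, f₄ x ∂Measure.pi μ) := by
  classical
  set e := (Fintype.equivFin ι).symm with he
  set E := MeasurableEquiv.piCongrLeft X e with hE
  have hmp : MeasurePreserving E (Measure.pi fun k => μ (e k)) (Measure.pi μ) := measurePreserving_piCongrLeft μ e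
  have tr : ∀ g : (∀ i, X i) → ℝ≥0∞, ∫⁻ x, g x ∂Measure.pi μ = ∫⁻ a, g (E a) ∂Measure.pi fun k => μ (e k) :=
    fun g => (hmp.lintegral_comp_emb E.measurableEmbedding g).symm
  rw [tr f₁, tr f₂, tr f₃, tr f₄]
  have h' : ∀ᵐ p ∂(Measure.pi fun k => μ (e k)).prod (Measure.pi fun k => μ (e k)),
      f₁ (E p.1) * f₂ (E p.2) ≤ f₃ (E (p.1 ⊔ p.2)) * f₄ (E (p.1 ⊓ p.2)) := by
    have hp := (hmp.prod hmp).quasiMeasurePreserving.ae h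
    filter_upwards [hp] with p hp
    have es : E (p.1 ⊔ p.2) = E p.1 ⊔ E p.2 := piCongrLeft_sup_dep e p.1 p.2
    have ei : E (p.1 ⊓ p.2) = E p.1 ⊓ E p.2 := piCongrLeft_inf_dep e p.1 p.2
    rw [es, ei]
    simpa [Prod.map] using hp
  exact lintegral_four_functions_pi_fin_ae (Fintype.card ι) (fun k => X (e k)) (fun k => μ (e k))
    (fun a => f₁ (E a)) (fun a => f₂ (E a)) (fun a => f₃ (E a)) (fun a => f₄ (E a)) (hm₁.comp E.measurable)
    (hm₂.comp E.measurable) (hm₃.comp E.measurable) (hm₄.comp E.measurable) h'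

/-! ### Set-TP₂ and affiliation of a.e.-pair MTP₂ densities on products of arbitrary chains -/

open Literature.Probability.LatticeModels.Affiliation in
/-- **An a.e.-pair MTP₂ density with respect to a product of σ-finite measures on ARBITRARY chains defines a set-TP₂
law** (`ν(A) ν(B) ≤ ν(A ∧ B) ν(A ∨ B)` for measurable `A, B`, image sets read with outer measure): Thm. 3.7 (strong
form) applied to `f·1_A, f·1_B` and measurable hulls of `A ∨ B`, `A ∧ B`.  The `ℝ^ι` case is
`Affiliation.mIsSetTP2_withDensity_pi_of_ae`. [cite: BattyBollmann1980, Thm. 3.7 with Remark 3.1(d)]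
[cite: MullerStoyan2002, Thm. 3.10.14 (i) ⇒ (ii)] -/
theorem mIsSetTP2_withDensity_pi_of_ae_chain (μ : ∀ i, Measure (X i)) [∀ i, SigmaFinite (μ i)]
    (f : (∀ i, X i) → ℝ≥0∞) (hf : Measurable f)
    (hMTP : ∀ᵐ p ∂(Measure.pi μ).prod (Measure.pi μ), f p.1 * f p.2 ≤ f (p.1 ⊓ p.2) * f (p.1 ⊔ p.2)) :
    mIsSetTP2 ((Measure.pi μ).withDensity f) := by
  intro A B hA hB
  set P := Measure.pi μ with hP
  set ν := P.withDensity f with hν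
  set T₃ := toMeasurable ν (A ⊻ B) with hT₃
  set T₄ := toMeasurable ν (A ⊼ B) with hT₄
  have mT₃ : MeasurableSet T₃ := measurableSet_toMeasurable _ _
  have mT₄ : MeasurableSet T₄ := measurableSet_toMeasurable _ _
  have AD := lintegral_four_functions_pi_ae μ (hf.indicator hA) (hf.indicator hB) (hf.indicator mT₃)
    (hf.indicator mT₄) (f₁ := A.indicator f) (f₂ := B.indicator f) (f₃ := T₃.indicator f) (f₄ := T₄.indicator f) (by
      filter_upwards [hMTP] with p hp
      by_cases hx : p.1 ∈ A
      · by_cases hy : p.2 ∈ B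
        · have h3 : p.1 ⊔ p.2 ∈ T₃ := subset_toMeasurable _ _ (Set.sup_mem_sups hx hy)
          have h4 : p.1 ⊓ p.2 ∈ T₄ := subset_toMeasurable _ _ (Set.inf_mem_infs hx hy)
          rw [Set.indicator_of_mem hx, Set.indicator_of_mem hy, Set.indicator_of_mem h3,
            Set.indicator_of_mem h4, mul_comm (f (p.1 ⊔ p.2))]
          exact hp
        · rw [Set.indicator_of_notMem hy, mul_zero]
          exact zero_le
      · rw [Set.indicator_of_notMem hx, zero_mul]
        exact zero_le)
  rw [lintegral_indicator hA, lintegral_indicator hB, lintegral_indicator mT₃, lintegral_indicator mT₄,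
    ← withDensity_apply f hA, ← withDensity_apply f hB, ← withDensity_apply f mT₃,
    ← withDensity_apply f mT₄] at AD
  rw [← hν, hT₃, hT₄, measure_toMeasurable, measure_toMeasurable] at AD
  calc ν A * ν B ≤ ν (A ⊻ B) * ν (A ⊼ B) := AD
    _ = ν (A ⊼ B) * ν (A ⊻ B) := mul_comm _ _

open Literature.Probability.LatticeModels.Affiliation in
/-- **… hence affiliated** (every conditional law on a measurable sublattice positively associated on increasing events).
[cite: BattyBollmann1980, Thm. 3.7 with (1.5)] -/
theorem mIsAffiliated_withDensity_pi_of_ae_chain (μ : ∀ i, Measure (X i)) [∀ i, SigmaFinite (μ i)]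
    (f : (∀ i, X i) → ℝ≥0∞) (hf : Measurable f)
    (hMTP : ∀ᵐ p ∂(Measure.pi μ).prod (Measure.pi μ), f p.1 * f p.2 ≤ f (p.1 ⊓ p.2) * f (p.1 ⊔ p.2)) :
    mIsAffiliated ((Measure.pi μ).withDensity f) :=
  (mIsSetTP2_withDensity_pi_of_ae_chain μ f hf hMTP).mIsAffiliated

end Fintype

end Literature.Probability.LatticeModels.BattyBollmann
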